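import Summits.RiemannHypothesis.RiemannHypothesis.Theorems.TiltedLandingLaw421R3RateUncoveredSign

/-!
# LEADING-ORDER DISSIPATION IDENTITY — Theorems IMAGE (lens-2 g7, (CA673)(B)/(D3); bytes of the crux workfile `Cruxes/TiltedLandingLaw421R/Lens2_LeadingDissipation.lean`
5c4c549cfc58be10 (lens-2 g5, 0 sorry, tree import only) re-homed UNCHANGED as §1, plus §2 = the `pairPull` DICTIONARY C1 g35's K-2 compose (MAP 92ca3b62 §1 S9, §4 D3) consumes)

§1 (pure real algebra, verbatim).  With `a = Im v`, `b = Im z`, `Δ = Re v − Re z`, `N₁ = Δ² + (a−b)²`, `N₂ = Δ² + (a+b)²` and the vertical pull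
`pull a b Δ := (b − a)/N₁ − (a + b)/N₂` of the pair `{z, z̄}` on a point at height `a`:
★ `cross_identity`: `a·pull a b Δ + b·pull b a Δ = −(a−b)²/N₁ − (a+b)²/N₂` (always `≤ 0`, `cross_nonpos`) — the two zeros of a pair only ADD to each
other's leading-order dissipation; ★ `leading_ge_two`: `2 ≤ 2 − 2·(a·pull a b Δ + b·pull b a Δ)`; ★ `leading_ge_three_of_touch`: `|Δ| ≤ a + b`, `0 < a + b` ⇒
`3 ≤ 2 − 2·(a·pull a b Δ + b·pull b a Δ)` (`(a+b)²/N₂ ≥ 1/2`); `foreign_nonneg`: uncovering foreign pulls (`≤ 0` each) contribute `≥ 0`.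
§2 (dictionary to tree #1176 `RhW08.UncoveredSign.pairPull`, new, routine): ★ `pairPull_eq_pull`: `pairPull v z = pull (Im v) (Im z) (Re v − Re z)`;
`pairPull_eq_pull'`: `pairPull z v = pull (Im z) (Im v) (Re v − Re z)`; ★ `leading_ge_three_of_touches`: `0 < Im v`, `0 ≤ Im z`… precisely `0 < Im v + Im z` and
`|Re v − Re z| ≤ Im v + Im z` ⇒ `3 ≤ 2 − 2·(Im v·pairPull v z + Im z·pairPull z v)` — the S9 input of the K-2 compose in PAIR language (equal unit weights; the
weights `(κ_v/‖K_w‖)²` and all `O(1/λ)` corrections are NOT here).  Imports: #1176 only (which imports `…R3BurgersRate`).  0 sorry.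
Nothing here bears on the truth of RH; RH is not proved; K-2 / RUNG-P's hypotheses / C′ / ★A OPEN; 33346 / 33347 OPEN; an identity is not a law.
-/

open RhIdea5.G17.W07C9.Helpers (normSq_sub_eq normSq_sub_conj_eq)

namespace RhW08.LeadingDissipation

/-- the vertical pull of the pair at height `b`, lateral offset `Δ`, on a point at height `a`: `(b − a)/(Δ² + (a−b)²) − (a + b)/(Δ² + (a+b)²)`. -/
noncomputable def pull (a b Δ : ℝ) : ℝ := (b - a) / (Δ ^ 2 + (a - b) ^ 2) - (a + b) / (Δ ^ 2 + (a + b) ^ 2)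

/-- `pull` is symmetric in the sign of `Δ` (so `P(z,v)` uses the same `Δ²`). -/
theorem pull_neg_delta (a b Δ : ℝ) : pull a b (-Δ) = pull a b Δ := by simp [pull]

/-- ★ THE CROSS IDENTITY: `a·P(v,z) + b·P(z,v) = −(a−b)²/N₁ − (a+b)²/N₂`. -/
theorem cross_identity (a b Δ : ℝ) :
    a * pull a b Δ + b * pull b a Δ = -((a - b) ^ 2 / (Δ ^ 2 + (a - b) ^ 2)) - (a + b) ^ 2 / (Δ ^ 2 + (a + b) ^ 2) := by
  simp only [pull]
  have h1 : (b - a) ^ 2 = (a - b) ^ 2 := by ring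
  rw [h1, show b + a = a + b by ring]
  ring

/-- the cross term is `≤ 0`: the two zeros of a pair only ever add to each other's leading-order dissipation. -/
theorem cross_nonpos (a b Δ : ℝ) : a * pull a b Δ + b * pull b a Δ ≤ 0 := by
  rw [cross_identity]
  have h1 : 0 ≤ (a - b) ^ 2 / (Δ ^ 2 + (a - b) ^ 2) := div_nonneg (sq_nonneg _) (by positivity)
  have h2 : 0 ≤ (a + b) ^ 2 / (Δ ^ 2 + (a + b) ^ 2) := div_nonneg (sq_nonneg _) (by positivity)
  linarith

/-- ★ `X₀ ≥ 2` for ANY pair of upper zeros (before foreign terms). -/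
theorem leading_ge_two (a b Δ : ℝ) : 2 ≤ 2 - 2 * (a * pull a b Δ + b * pull b a Δ) := by
  have := cross_nonpos a b Δ; linarith

/-- ★ `X₀ ≥ 3` for a TOUCHING pair (`|Δ| ≤ a + b`, `0 < a + b`): the conjugate attraction term `(a+b)²/N₂` is `≥ 1/2`. -/
theorem leading_ge_three_of_touch {a b Δ : ℝ} (hab : 0 < a + b) (ht : |Δ| ≤ a + b) :
    3 ≤ 2 - 2 * (a * pull a b Δ + b * pull b a Δ) := by
  rw [cross_identity]
  have hN2 : 0 < Δ ^ 2 + (a + b) ^ 2 := by positivity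
  have hΔ : Δ ^ 2 ≤ (a + b) ^ 2 := by
    have h := sq_le_sq' (by linarith [neg_abs_le Δ, abs_nonneg Δ]) ht
    simpa using h
  have h2 : 1 / 2 ≤ (a + b) ^ 2 / (Δ ^ 2 + (a + b) ^ 2) := by
    rw [div_le_div_iff₀ (by norm_num) hN2]; nlinarith
  have h1 : 0 ≤ (a - b) ^ 2 / (Δ ^ 2 + (a - b) ^ 2) := div_nonneg (sq_nonneg _) (by positivity)
  linarith

/-- ★ the foreign terms: if a foreign pair pulls BOTH `v` and `z` down or not at all (`P(v,u) ≤ 0`, `P(z,u) ≤ 0` — both uncovered by `u`), its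
contribution `−2·(a·P(v,u) + b·P(z,u))` to `X₀` is `≥ 0`. -/
theorem foreign_nonneg {a b Pv Pz : ℝ} (ha : 0 ≤ a) (hb : 0 ≤ b) (hv : Pv ≤ 0) (hz : Pz ≤ 0) : 0 ≤ -2 * (a * Pv + b * Pz) := by
  nlinarith [mul_nonpos_iff.2 (Or.inl ⟨ha, hv⟩), mul_nonpos_iff.2 (Or.inl ⟨hb, hz⟩)]

/-- the WΓ numbers (`a = 1/10`, `b = 1/5`, `Δ = 4/25`): `X₀ = 2 + 0.5618 + 1.5571 = 4.119` — bracket `4.11 < X₀ < 4.12`. -/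
example : (411 : ℝ) / 100 < 2 - 2 * ((1 / 10) * pull (1 / 10) (1 / 5) (4 / 25) + (1 / 5) * pull (1 / 5) (1 / 10) (4 / 25)) ∧
    2 - 2 * ((1 / 10) * pull (1 / 10) (1 / 5) (4 / 25) + (1 / 5) * pull (1 / 5) (1 / 10) (4 / 25)) < (412 : ℝ) / 100 := by
  constructor <;> norm_num [pull]


/-! ## §2 Dictionary to `RhW08.UncoveredSign.pairPull` (tree #1176) -/

/-- ★ `pairPull v z = pull (Im v) (Im z) (Re v − Re z)` (`|v − z|² = Δ² + (a − b)²`, `|v − z̄|² = Δ² + (a + b)²`). -/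
theorem pairPull_eq_pull (v z : ℂ) : RhW08.UncoveredSign.pairPull v z = pull v.im z.im (v.re - z.re) := by
  rw [RhW08.UncoveredSign.pairPull, normSq_sub_eq, normSq_sub_conj_eq, pull]
  ring_nf

/-- the partner's pull with the SAME offset `Δ = Re v − Re z`: `pairPull z v = pull (Im z) (Im v) (Re v − Re z)` (`pull_neg_delta`). -/
theorem pairPull_eq_pull' (v z : ℂ) : RhW08.UncoveredSign.pairPull z v = pull z.im v.im (v.re - z.re) := by
  rw [pairPull_eq_pull, show z.re - v.re = -(v.re - z.re) by ring, pull_neg_delta]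

/-- ★ S9 of the K-2 compose in pair language: a TOUCHING pair (`|Re v − Re z| ≤ Im v + Im z`, `0 < Im v + Im z`) has leading sum `≥ 3`:
`3 ≤ 2 − 2·(Im v·pairPull v z + Im z·pairPull z v)`. -/
theorem leading_ge_three_of_touches {v z : ℂ} (hab : 0 < v.im + z.im) (ht : |v.re - z.re| ≤ v.im + z.im) :
    3 ≤ 2 - 2 * (v.im * RhW08.UncoveredSign.pairPull v z + z.im * RhW08.UncoveredSign.pairPull z v) := by
  rw [pairPull_eq_pull, pairPull_eq_pull']
  exact leading_ge_three_of_touch hab ht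

end RhW08.LeadingDissipation
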